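import Mathlib
import Literature.NumberTheory.LFunctions.SuzukiWeilHilbertSpace
import Literature.NumberTheory.LFunctions.LiCoefficientsModelSpaceRH
import Literature.NumberTheory.LFunctions.LagariasXiStructureFunctionProofs
import Literature.Analysis.DeBrangesSpaces.ReproducingKernelRealZeros
import Literature.Analysis.DeBrangesSpaces.HalfPlanePaleyWiener
import Literature.Analysis.Fourier.L2FourierConj
import Literature.Analysis.Fourier.L2FourierReflection
import HarnessLib

/-!
# The reproducing-kernel inequality for `E_ξ𝖥(V(0))` on the upper half-plane, under RH

LINE 1 — LABEL: RH-CONSEQUENCE proofs (explicit binder `RiemannHypothesis →`) about RH-FREE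
objects of the cell rh-crit/dbl (`V(0)`, `𝖪`, `Θ_ξ`; M. Suzuki, *On the Hilbert space derived
from the Weil distribution*, Canad. J. Math. 2025 = arXiv:2301.00421v3, §2.2–2.4 and Lemma 5.1).
bears_on: B-C/B-P (LADDER-RH COLUMN 6 DBR) as corpus infrastructure. WHAT THIS IS NOT: an estimate
for elements of an RH-free Hilbert space under the RH binder; it discharges no named fact and does
not bear on the truth of RH.

## What is proved (under RH)

* `integral_lagariasTheta_div_norm_sq` — the **Poisson representation of `Θ_ξ`**:
  `∫_ℝ Θ(u)/|u − z|² du = π Θ(z)/Im z` for `Im z > 0` (`Θ = E♯/E` is bounded and holomorphic on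
  `ℂ₊` and continues across the real zeros of `E`; Cauchy's formula along `ℝ`,
  `DeBrangesSpaces.integral_div_sub_eq_of_im_pos`).
* `inner_suzukiK_suzukiK` — `𝖪` is anti-unitary: `⟪𝖪a, 𝖪b⟫ = ⟪b, a⟫` (RH-FREE).
* `norm_sq_upperHalfHat_le_of_mem_suzukiV` — for `ψ ∈ V(0)` and `Im z > 0`,
  **`|ψ̂(z)|² ≤ ‖ψ‖² (1 − |Θ(z)|²)/(2 Im z)`**: `ψ̂(z) = ⟪e_z, ψ⟫` with `e_z = 1_{(0,∞)}e^{−iz̄x}`,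
  `⟪𝖪φ_z, ψ⟫ = 0` for `φ_z = 𝖩Re_z ∈ L²(−∞,0)` (anti-unitarity and `𝖪ψ ∈ L²(0,∞)`), and
  `⟪e_z, 𝖪φ_z⟫ = ∫ Θ̃ |𝓕e_z|² = Θ(z)‖e_z‖²` by the Poisson representation; hence
  `|⟪e_z − Θ̄(z)𝖪φ_z, ψ⟫|² ≤ ‖e_z‖²(1 − |Θ(z)|²)‖ψ‖²`. This is the reproducing-kernel norm of
  the model space `𝒦(Θ)` (CJM (2.6): `‖K(z,·)‖² = (1 − |Θ(z)|²)/(4π Im z)` in Suzuki's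
  normalisation) obtained WITHOUT model-space theory.
* `norm_sq_lagariasE_mul_upperHalfHat_le` — consequently `|E(z)ψ̂(z)|² ≤ 2π‖ψ‖²·K(z,z)` with
  `K(z,z) = (|E(z)|² − |E(z̄)|²)/(4π Im z)` (`deBrangesKernelDiag`): Conrey–Li's inequality (2.1) /
  de Branges' axiom for `Φ = Eψ̂` on the UPPER half-plane (the lower half-plane needs the gluing
  `Φ|ℂ₋ = E♯·conj((𝖪ψ)̂(z̄))`, not proved here).

## References
* M. Suzuki, Canad. J. Math. 2025 = arXiv:2301.00421v3, §2.2 (2.4)–(2.6), §2.4 (2.7), Lemma 5.1. [Suzuki2025WeilHilbertSpace]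
* J. B. Conrey, X.-J. Li, IMRN 2000, §2 (2.1). [ConreyLi2000]
-/

noncomputable section

open MeasureTheory Complex Filter Set FourierTransform
open scoped ComplexConjugate FourierTransform Topology Real ENNReal InnerProductSpace

namespace Literature.NumberTheory.LFunctions

open ZetaZeros Literature.Analysis.DeBrangesSpaces Literature.Analysis.Fourier

namespace SuzukiKernelBound

/-! ## A. The continuation of `Θ_ξ` to the closed upper half-plane and its Poisson representation -/

/-- Under RH, `Θ_ξ = E♯/E` agrees, off the zeros of `E`, with a function complex differentiable at
every point of the closed upper half-plane (the real zeros of `E` are removable: de Branges'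
continuation lemma applied to the entire function `E♯(z)e^{−z²}`, whose quotient by `E` is
square-integrable on `ℝ`). RH-CONSEQUENCE. [cite: Suzuki2025WeilHilbertSpace, CJM §3.2 p. 8 (TeX l.985–990: "the zeros of E on the real line cancel out")] -/
theorem exists_continuation_lagariasTheta (hRH : RiemannHypothesis) :
    ∃ T : ℂ → ℂ, (∀ z : ℂ, 0 ≤ z.im → DifferentiableAt ℂ T z) ∧
      ∀ z : ℂ, lagariasE z ≠ 0 → T z = lagariasTheta z := by
  have hE : IsHermiteBiehler lagariasE := Lagarias2006_thm1_onlyif_holds hRH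
  -- the entire function `F(z) = E♯(z) e^{−z²}`
  set F : ℂ → ℂ := fun z ↦ sharp lagariasE z * cexp (-z ^ 2) with hF
  have hFd : Differentiable ℂ F :=
    (differentiable_sharp differentiable_lagariasE).mul
      (Complex.differentiable_exp.comp (differentiable_pow 2).neg)
  have hF2 : Integrable fun x : ℝ ↦ ‖F x / lagariasE x‖ ^ 2 := by
    have hg : Integrable fun x : ℝ ↦ Real.exp (-(2 : ℝ) * x ^ 2) := by
      have := integrable_exp_neg_mul_sq (by norm_num : (0 : ℝ) < 2)
      exact this.congr (ae_of_all _ fun x ↦ by ring_nf)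
    refine hg.mono' ?_ (ae_of_all _ fun x ↦ ?_)
    · have hm : Measurable fun x : ℝ ↦ F x / lagariasE x :=
        (hFd.continuous.measurable.comp Complex.measurable_ofReal).div
          (continuous_lagariasE.measurable.comp Complex.measurable_ofReal)
      exact (hm.norm.pow_const 2).aestronglyMeasurable
    · rw [Real.norm_of_nonneg (by positivity), hF]
      simp only
      rw [mul_div_right_comm, norm_mul, mul_pow, Complex.norm_exp]
      have h1 : ‖sharp lagariasE x / lagariasE x‖ ≤ 1 := norm_lagariasTheta_ofReal_le_one x
      have h2 : (-(x : ℂ) ^ 2).re = -x ^ 2 := by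
        rw [neg_re, ← Complex.ofReal_pow, Complex.ofReal_re]
      rw [h2, ← Real.exp_nat_mul]
      have h3 : ‖sharp lagariasE x / lagariasE x‖ ^ 2 ≤ 1 := by
        simpa using pow_le_one₀ (norm_nonneg _) h1 (n := 2)
      calc ‖sharp lagariasE ↑x / lagariasE ↑x‖ ^ 2 * Real.exp (↑2 * -x ^ 2)
          ≤ 1 * Real.exp (↑2 * -x ^ 2) := by gcongr
        _ = Real.exp (-2 * x ^ 2) := by ring_nf
  obtain ⟨Q, hQd, hQ⟩ := exists_continuation_div hE hFd hF2
  refine ⟨fun z ↦ Q z * cexp (z ^ 2), fun z hz ↦ (hQd z hz).mul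
    (Complex.differentiable_exp.comp (differentiable_pow 2) z), fun z hEz ↦ ?_⟩
  simp only
  rw [hQ z hEz, hF, lagariasTheta]
  simp only
  rw [div_mul_eq_mul_div, mul_assoc, ← Complex.exp_add, neg_add_cancel, Complex.exp_zero, mul_one]

/-- **Poisson representation of `Θ_ξ` (under RH)**: `∫_ℝ Θ(u)/|u − z|² du = π Θ(z)/Im z` for
`Im z > 0` (Cauchy's formula along `ℝ` for `Θ/(· − z̄)`, bounded by `1/|· − z̄|` on `ℂ₊`).
RH-CONSEQUENCE. [cite: Suzuki2025WeilHilbertSpace, CJM §2.4 p. 5 (TeX l.689–700: Θ inner in ℂ₊) and §3.2 p. 8] -/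
theorem integral_lagariasTheta_div_norm_sq (hRH : RiemannHypothesis) {z : ℂ} (hz : 0 < z.im) :
    ∫ u : ℝ, lagariasTheta u / (((‖(u : ℂ) - z‖ ^ 2 : ℝ)) : ℂ) =
      ((π / z.im : ℝ) : ℂ) * lagariasTheta z := by
  have hE : IsHermiteBiehler lagariasE := Lagarias2006_thm1_onlyif_holds hRH
  obtain ⟨T, hTd, hT⟩ := exists_continuation_lagariasTheta hRH
  have hzc : (conj z).im < 0 := by rw [Complex.conj_im]; linarith
  -- `g = T/(· − z̄)` on the closed upper half-plane
  set g : ℂ → ℂ := fun w ↦ T w / (w - conj z) with hg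
  have hne : ∀ w : ℂ, 0 ≤ w.im → w - conj z ≠ 0 := by
    intro w hw h
    have := congrArg Complex.im h
    rw [sub_im, Complex.conj_im, zero_im] at this
    linarith
  have hgd : ∀ w : ℂ, 0 ≤ w.im → DifferentiableAt ℂ g w := fun w hw ↦
    (hTd w hw).div (differentiableAt_id.sub_const _) (hne w hw)
  -- `|T| ≤ 1` on the open upper half-plane, `= 1` a.e. on `ℝ`
  have hT1 : ∀ w : ℂ, 0 < w.im → ‖T w‖ ≤ 1 := by
    intro w hw
    have hEw : lagariasE w ≠ 0 := lagariasE_ne_zero_of_im_pos hRH hw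
    rw [hT w hEw, lagariasTheta, norm_div, div_le_one (norm_pos_iff.2 hEw)]
    exact (hE.norm_sharp_lt hw).le
  have hgi : Integrable fun x : ℝ ↦ ‖g x‖ ^ 2 := by
    refine (integrable_norm_inv_ofReal_sub_sq hzc.ne).congr ?_
    filter_upwards [ae_lagariasE_ofReal_ne_zero] with x hx
    rw [hg]
    simp only
    rw [norm_div, hT _ hx, norm_lagariasTheta_ofReal hx, norm_inv, one_div]
  have hgb : ∀ w : ℂ, 0 < w.im → max 1 (2 * ‖z‖) ≤ ‖w‖ → ‖g w‖ ≤ 2 / √w.im := by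
    intro w hw hR
    have h1 : (1 : ℝ) ≤ ‖w‖ := (le_max_left _ _).trans hR
    have h2 : 2 * ‖z‖ ≤ ‖w‖ := (le_max_right _ _).trans hR
    have hwz : ‖w‖ / 2 ≤ ‖w - conj z‖ := by
      have := norm_sub_norm_le w (conj z)
      rw [Complex.norm_conj] at this
      linarith
    have hsqrt : √w.im ≤ ‖w‖ := sqrt_im_le_norm h1
    have hwpos : 0 < ‖w‖ := by linarith
    rw [hg]
    simp only
    rw [norm_div]
    calc ‖T w‖ / ‖w - conj z‖ ≤ 1 / (‖w‖ / 2) :=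
          div_le_div₀ zero_le_one (hT1 w hw) (by positivity) hwz
      _ = 2 / ‖w‖ := by field_simp
      _ ≤ 2 / √w.im := by gcongr
  have hC := integral_div_sub_eq_of_im_pos (by norm_num : (0 : ℝ) ≤ 2) hgd hgi hgb hz
  -- read off
  have hlhs : ∫ u : ℝ, lagariasTheta u / (((‖(u : ℂ) - z‖ ^ 2 : ℝ)) : ℂ) =
      ∫ x : ℝ, g x / (x - z) := by
    refine integral_congr_ae ?_
    filter_upwards [ae_lagariasE_ofReal_ne_zero] with x hx
    rw [hg]
    simp only
    rw [hT _ hx, div_div]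
    congr 1
    have : ((x : ℂ) - conj z) = conj ((x : ℂ) - z) := by simp
    rw [this, mul_comm, Complex.mul_conj, Complex.normSq_eq_norm_sq]
  have hEz : lagariasE z ≠ 0 := lagariasE_ne_zero_of_im_pos hRH hz
  rw [hlhs, hC, hg]
  simp only
  rw [hT z hEz]
  have hzz : z - conj z = ((2 * z.im : ℝ) : ℂ) * I := by
    rw [Complex.sub_conj]
  rw [hzz]
  have him : (z.im : ℂ) ≠ 0 := Complex.ofReal_ne_zero.2 hz.ne'
  push_cast
  field_simp

/-! ## B. `𝖪` is anti-unitary; `𝖩² = id`; the reflected conjugate of a right-supported class -/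

/-- `𝖩(𝖩f) = f`. [cite: Suzuki2025WeilHilbertSpace, CJM §5 p. 13 (TeX l.1436–1441)] -/
theorem suzukiJ_suzukiJ (f : Lp ℂ 2 (volume : Measure ℝ)) : suzukiJ (suzukiJ f) = f := by
  refine Lp.ext ?_
  filter_upwards [coeFn_suzukiJ (suzukiJ f), coeFn_suzukiJ f] with x h1 h2
  rw [h1, h2, Complex.conj_conj]

/-- **`𝖪` is anti-unitary**: `⟪𝖪a, 𝖪b⟫ = ⟪b, a⟫` (`𝓕` unitary, `|Θ̃| = 1` a.e.). RH-FREE.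
[cite: Suzuki2025WeilHilbertSpace, CJM §5 p. 13 (TeX l.1441–1444: "𝖪 is an isometric … conjugate linear" map)] -/
theorem inner_suzukiK_suzukiK (a b : Lp ℂ 2 (volume : Measure ℝ)) :
    inner ℂ (suzukiK a) (suzukiK b) = inner ℂ b a := by
  unfold suzukiK
  rw [← Lp.inner_fourier_eq, fourier_fourierInv_eq, fourier_fourierInv_eq, L2.inner_def,
    ← Lp.inner_fourier_eq b a, L2.inner_def]
  refine integral_congr_ae ?_
  filter_upwards [coeFn_suzukiM (suzukiJ (𝓕 a : Lp ℂ 2 (volume : Measure ℝ))),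
    coeFn_suzukiM (suzukiJ (𝓕 b : Lp ℂ 2 (volume : Measure ℝ))),
    coeFn_suzukiJ (𝓕 a : Lp ℂ 2 (volume : Measure ℝ)), coeFn_suzukiJ (𝓕 b : Lp ℂ 2 (volume : Measure ℝ)),
    norm_suzukiMultiplier_eq_one_ae] with ξ h1 h2 h3 h4 h5
  rw [h1, h2, h3, h4, RCLike.inner_apply, RCLike.inner_apply, map_mul, Complex.conj_conj]
  have hΘ : suzukiMultiplier ξ * conj (suzukiMultiplier ξ) = 1 := by
    rw [Complex.mul_conj, Complex.normSq_eq_norm_sq, h5]; norm_num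
  linear_combination ((𝓕 a : Lp ℂ 2 (volume : Measure ℝ)) : ℝ → ℂ) ξ *
    conj (((𝓕 b : Lp ℂ 2 (volume : Measure ℝ)) : ℝ → ℂ) ξ) * hΘ

/-- For `ψ ∈ V(0)` and `φ` vanishing a.e. on `(0,∞)`: `⟪𝖪φ, ψ⟫ = 0` (anti-unitarity, `𝖪² = id`,
and `𝖪ψ ∈ L²(0,∞)`). RH-FREE. [cite: Suzuki2025WeilHilbertSpace, CJM Lemma 5.1 proof p. 13 (TeX l.1489–1493)] -/
theorem inner_suzukiK_eq_zero_of_mem_suzukiV {ψ φ : Lp ℂ 2 (volume : Measure ℝ)}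
    (hψ : ψ ∈ suzukiV 0) (hφ : ∀ᵐ x : ℝ, 0 < x → (φ : ℝ → ℂ) x = 0) :
    inner ℂ (suzukiK φ) ψ = 0 := by
  have hKψ : suzukiK ψ ∈ halfLineL2 0 := (mem_suzukiV_iff.1 hψ).2
  have h1 : inner ℂ (suzukiK φ) ψ = inner ℂ (suzukiK ψ) φ := by
    conv_lhs => rw [← suzukiK_suzukiK ψ]
    exact inner_suzukiK_suzukiK φ (suzukiK ψ)
  rw [h1, L2.inner_def]
  have hpt : ∀ᵐ x : ℝ, x ≠ 0 := compl_mem_ae_iff.2 (measure_singleton (0 : ℝ))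
  refine integral_eq_zero_of_ae ?_
  filter_upwards [hKψ, hφ, hpt] with x h2 h3 h4
  rcases lt_or_gt_of_ne h4 with hneg | hpos
  · rw [Pi.zero_apply, RCLike.inner_apply, h2 hneg, map_zero, mul_zero]
  · rw [Pi.zero_apply, RCLike.inner_apply, h3 hpos, zero_mul]

/-! ## C. The kernel `e_z = 1_{(0,∞)}e^{−iz̄x}`, its transform, and `⟪e_z, 𝖪φ_z⟫ = Θ(z)‖e_z‖²` -/

/-- `∫₀^∞ e^{ax} e^{−2πixξ} dx = 1/(2πiξ − a)` for `Re a < 0`. [cite: Rudin1987, Thm. 19.2 (proof)] -/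
private theorem fourier_indicator_Ioi_cexp {a : ℂ} (ha : a.re < 0) (ξ : ℝ) :
    𝓕 ((Ioi (0 : ℝ)).indicator fun x : ℝ ↦ cexp (a * x)) ξ = 1 / (2 * π * I * ξ - a) := by
  rw [Real.fourier_real_eq_integral_exp_smul]
  have h1 : ∀ v : ℝ, cexp (↑(-2 * π * v * ξ) * I) • (Ioi (0 : ℝ)).indicator
      (fun x : ℝ ↦ cexp (a * x)) v =
      (Ioi (0 : ℝ)).indicator (fun x : ℝ ↦ cexp ((a - 2 * π * I * ξ) * x)) v := by
    intro v
    by_cases hv : v ∈ Ioi (0 : ℝ)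
    · rw [indicator_of_mem hv, indicator_of_mem hv, smul_eq_mul, ← Complex.exp_add]
      congr 1
      push_cast
      ring
    · rw [indicator_of_notMem hv, indicator_of_notMem hv, smul_zero]
  simp_rw [h1]
  rw [integral_indicator measurableSet_Ioi]
  have hre : (a - 2 * π * I * ξ).re < 0 := by
    simp [Complex.mul_re, Complex.mul_im]; linarith
  rw [integral_exp_mul_complex_Ioi hre 0]
  simp only [Complex.ofReal_zero, mul_zero, Complex.exp_zero]
  rw [show (2 * π * I * ξ - a : ℂ) = -(a - 2 * π * I * ξ) by ring, one_div_neg_eq_neg_one_div,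
    neg_div]

/-- The half-line exponential `1_{(0,∞)} e^{ax}`, `Re a < 0`, is integrable. [cite: Rudin1987, Thm. 19.2 (proof)] -/
private theorem integrable_indicator_Ioi_cexp {a : ℂ} (ha : a.re < 0) :
    Integrable ((Ioi (0 : ℝ)).indicator fun x : ℝ ↦ cexp (a * x)) :=
  (integrableOn_exp_mul_complex_Ioi ha 0).integrable_indicator measurableSet_Ioi

/-- The half-line exponential `1_{(0,∞)} e^{ax}`, `Re a < 0`, is square-integrable, with
`∫ |1_{(0,∞)}e^{ax}|² = −1/(2 Re a)`. [cite: Rudin1987, Thm. 19.2 (proof)] -/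
private theorem memLp_two_indicator_Ioi_cexp {a : ℂ} (ha : a.re < 0) :
    MemLp ((Ioi (0 : ℝ)).indicator fun x : ℝ ↦ cexp (a * x)) 2 volume ∧
      ∫ x : ℝ, ‖(Ioi (0 : ℝ)).indicator (fun x : ℝ ↦ cexp (a * x)) x‖ ^ 2 = -1 / (2 * a.re) := by
  have hmeas : AEStronglyMeasurable ((Ioi (0 : ℝ)).indicator fun x : ℝ ↦ cexp (a * x)) volume :=
    (integrable_indicator_Ioi_cexp ha).aestronglyMeasurable
  have hpt : ∀ x : ℝ, ‖(Ioi (0 : ℝ)).indicator (fun x : ℝ ↦ cexp (a * x)) x‖ ^ 2 =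
      (Ioi (0 : ℝ)).indicator (fun x : ℝ ↦ Real.exp (2 * a.re * x)) x := by
    intro x
    by_cases hx : x ∈ Ioi (0 : ℝ)
    · simp only [indicator_of_mem hx, Complex.norm_exp]
      rw [← Real.exp_nat_mul]
      congr 1
      simp [Complex.mul_re]
      ring
    · simp [indicator_of_notMem hx]
  have hint : Integrable fun x : ℝ ↦ (Ioi (0 : ℝ)).indicator (fun x : ℝ ↦ Real.exp (2 * a.re * x)) x :=
    (exp_neg_integrableOn_Ioi 0 (by linarith : 0 < -(2 * a.re))).integrable_indicator
      measurableSet_Ioi |>.congr (ae_of_all _ fun x ↦ by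
        by_cases hx : x ∈ Ioi (0 : ℝ)
        · simp only [indicator_of_mem hx]; ring_nf
        · simp only [indicator_of_notMem hx])
  refine ⟨(memLp_two_iff_integrable_sq_norm hmeas).2 (hint.congr (ae_of_all _ fun x ↦
    (hpt x).symm)), ?_⟩
  simp_rw [hpt]
  rw [integral_indicator measurableSet_Ioi, integral_exp_mul_Ioi (by linarith) 0]
  simp only [mul_zero, Real.exp_zero]


/-! ## D. The estimate `|ψ̂(z)|² ≤ ‖ψ‖²(1 − |Θ(z)|²)/(2 Im z)` on `V(0)` -/

/-- **The model-space kernel bound on `V(0)` (under RH)**: for `ψ ∈ V(0)` and `Im z > 0`,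
`|ψ̂(z)|² ≤ ‖ψ‖²_{L²} · (1 − |Θ_ξ(z)|²)/(2 Im z)` — the norm of the reproducing kernel of
`𝒦(Θ) = 𝖥V(0)` at `z` (CJM (2.6) in Suzuki's normalisation `‖𝖥ψ‖² = 2π‖ψ‖²`), obtained from
`ψ̂(z) = ⟪e_z, ψ⟫`, `⟪𝖪φ_z, ψ⟫ = 0` (`φ_z = 𝖩e_z(−·) ∈ L²(−∞,0)`) and
`⟪e_z, 𝖪φ_z⟫ = Θ(z)‖e_z‖²` (Poisson representation of `Θ`). RH-CONSEQUENCE.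
[cite: Suzuki2025WeilHilbertSpace, CJM §2.4 eq. (2.6)–(2.7) p. 5 and Lemma 5.1 p. 13] -/
theorem norm_sq_upperHalfHat_le_of_mem_suzukiV (hRH : RiemannHypothesis)
    {ψ : Lp ℂ 2 (volume : Measure ℝ)} (hψ : ψ ∈ suzukiV 0) {z : ℂ} (hz : 0 < z.im) :
    ‖upperHalfHat ψ z‖ ^ 2 ≤ ‖ψ‖ ^ 2 * ((1 - ‖lagariasTheta z‖ ^ 2) / (2 * z.im)) := by
  -- the kernel `e_z`
  set a : ℂ := -(I * conj z) with ha_def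
  have ha : a.re < 0 := by
    rw [ha_def, neg_re, Complex.mul_re, Complex.I_re, Complex.I_im, Complex.conj_re, Complex.conj_im]
    linarith
  have hare : a.re = -z.im := by
    rw [ha_def, neg_re, Complex.mul_re, Complex.I_re, Complex.I_im, Complex.conj_re, Complex.conj_im]
    ring
  set e : ℝ → ℂ := (Ioi (0 : ℝ)).indicator fun x : ℝ ↦ cexp (a * x) with he_def
  have he1 : Integrable e := integrable_indicator_Ioi_cexp ha
  obtain ⟨he2, henorm⟩ := memLp_two_indicator_Ioi_cexp ha
  set E : Lp ℂ 2 (volume : Measure ℝ) := he2.toLp e with hE_def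
  have hEnorm : ‖E‖ ^ 2 = 1 / (2 * z.im) := by
    have h1 : ‖E‖ ^ 2 = ∫ x : ℝ, ‖(E : ℝ → ℂ) x‖ ^ 2 := by
      have hi : inner ℂ E E = ((‖E‖ ^ 2 : ℝ) : ℂ) := by
        rw [inner_self_eq_norm_sq_to_K]; norm_cast
      have hi' : inner ℂ E E = ((∫ x : ℝ, ‖(E : ℝ → ℂ) x‖ ^ 2 : ℝ) : ℂ) := by
        rw [L2.inner_def, ← integral_complex_ofReal]
        refine integral_congr_ae (ae_of_all _ fun x ↦ ?_)
        beta_reduce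
        rw [inner_self_eq_norm_sq_to_K]
        norm_cast
      exact_mod_cast Complex.ofReal_injective (hi.symm.trans hi')
    rw [h1]
    have h2 : ∫ x : ℝ, ‖(E : ℝ → ℂ) x‖ ^ 2 = ∫ x : ℝ, ‖e x‖ ^ 2 := by
      refine integral_congr_ae ?_
      filter_upwards [he2.coeFn_toLp] with x hx
      rw [hx]
    rw [h2, henorm, hare]
    field_simp
  -- `ψ̂(z) = ⟪e_z, ψ⟫`
  have hhat : upperHalfHat ψ z = inner ℂ E ψ := by
    rw [L2.inner_def, upperHalfHat, ← integral_indicator measurableSet_Ioi]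
    refine integral_congr_ae ?_
    filter_upwards [he2.coeFn_toLp] with x hx
    rw [RCLike.inner_apply, hx]
    by_cases hxm : x ∈ Ioi (0 : ℝ)
    · rw [indicator_of_mem hxm, indicator_of_mem hxm, ← Complex.exp_conj, map_mul,
        Complex.conj_ofReal, ha_def, map_neg, map_mul, Complex.conj_I, Complex.conj_conj]
      congr 2
      ring
    · rw [indicator_of_notMem hxm, indicator_of_notMem hxm, map_zero, mul_zero]
  -- the Fourier transform `κ = 𝓕 e_z`
  set κ : Lp ℂ 2 (volume : Measure ℝ) := 𝓕 E with hκ_def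
  have hκ : (κ : ℝ → ℂ) =ᵐ[volume] fun ξ : ℝ ↦ 1 / (2 * π * I * ξ - a) := by
    filter_upwards [Literature.Analysis.FunctionSpaces.fourier_toLp_ae_eq_fourierIntegral he1 he2]
      with ξ hξ
    rw [hκ_def, hE_def, hξ, he_def, fourier_indicator_Ioi_cexp ha]
  -- the reflected conjugate `φ = 𝖩(e_z(−·))` and `𝖪φ = 𝓕⁻(𝖬κ)`
  set R : Lp ℂ 2 (volume : Measure ℝ) → Lp ℂ 2 (volume : Measure ℝ) := fun u ↦
    Lp.compMeasurePreserving (fun x : ℝ ↦ -x) (Measure.measurePreserving_neg (volume : Measure ℝ)) u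
    with hR_def
  set φ : Lp ℂ 2 (volume : Measure ℝ) := suzukiJ (R E) with hφ_def
  have hKφ : suzukiK φ = 𝓕⁻ (suzukiM κ) := by
    have h1 : (𝓕 (suzukiJ (R E)) : Lp ℂ 2 (volume : Measure ℝ)) = suzukiJ (𝓕⁻ (R E)) := by
      unfold suzukiJ; exact fourier_conjLp (R E)
    have h2 : (𝓕⁻ (R E) : Lp ℂ 2 (volume : Measure ℝ)) = κ := by
      rw [hR_def]
      simp only
      rw [fourierInv_eq_compNeg_fourier, fourier_compNeg, compNeg_compNeg]
    rw [suzukiK, hφ_def, h1, h2, suzukiJ_suzukiJ]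
  -- `φ` vanishes a.e. on `(0, ∞)`
  have hφ0 : ∀ᵐ x : ℝ, 0 < x → (φ : ℝ → ℂ) x = 0 := by
    have hq : Measure.QuasiMeasurePreserving (fun x : ℝ ↦ -x) volume volume :=
      (Measure.measurePreserving_neg (volume : Measure ℝ)).quasiMeasurePreserving
    filter_upwards [coeFn_suzukiJ (R E), coeFn_compNeg E, hq.ae he2.coeFn_toLp] with x h1 h2 h3 hx
    rw [hφ_def, h1, hR_def]
    simp only
    rw [h2, h3, indicator_of_notMem (by simpa using hx.le), map_zero]
  have horth : inner ℂ (suzukiK φ) ψ = 0 := inner_suzukiK_eq_zero_of_mem_suzukiV hψ hφ0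
  -- `⟪e_z, 𝖪φ⟫ = Θ(z) ‖e_z‖²`
  have hT : inner ℂ E (suzukiK φ) = lagariasTheta z * ((‖E‖ ^ 2 : ℝ) : ℂ) := by
    rw [← Lp.inner_fourier_eq, hKφ, fourier_fourierInv_eq, L2.inner_def]
    have h1 : ∫ ξ : ℝ, inner ℂ ((κ : ℝ → ℂ) ξ) ((suzukiM κ : ℝ → ℂ) ξ) =
        ∫ ξ : ℝ, (fun u : ℝ ↦ lagariasTheta u / (((‖(u : ℂ) - z‖ ^ 2 : ℝ)) : ℂ)) (-(2 * π) * ξ) := by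
      refine integral_congr_ae ?_
      filter_upwards [coeFn_suzukiM κ, hκ] with ξ h1 h2
      rw [RCLike.inner_apply, h1, h2, suzukiMultiplier]
      have e1 : ((-2 * Real.pi * ξ : ℝ) : ℂ) = ((-(2 * π) * ξ : ℝ) : ℂ) := by push_cast; ring
      set c : ℂ := (((-(2 * π) * ξ : ℝ)) : ℂ) - z with hc_def
      have hden : (2 * π * I * ξ - a) = -I * conj c := by
        rw [ha_def, hc_def, map_sub, Complex.conj_ofReal]
        push_cast
        ring
      have hprod : (1 / (-I * conj c)) * conj (1 / (-I * conj c)) = 1 / (((‖c‖ ^ 2 : ℝ)) : ℂ) := by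
        rw [map_div₀, map_one, div_mul_div_comm, one_mul, Complex.mul_conj, Complex.normSq_eq_norm_sq,
          norm_mul, norm_neg, Complex.norm_I, one_mul, Complex.norm_conj]
      rw [e1, hden, mul_assoc, hprod, mul_one_div]
    rw [h1, Measure.integral_comp_mul_left
      (fun u : ℝ ↦ lagariasTheta u / (((‖(u : ℂ) - z‖ ^ 2 : ℝ)) : ℂ)) (-(2 * π)),
      integral_lagariasTheta_div_norm_sq hRH hz, hEnorm, abs_inv, abs_neg, abs_of_pos Real.two_pi_pos,
      Complex.real_smul]
    have hπ : (π : ℂ) ≠ 0 := Complex.ofReal_ne_zero.2 Real.pi_ne_zero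
    have him : (z.im : ℂ) ≠ 0 := Complex.ofReal_ne_zero.2 hz.ne'
    push_cast
    field_simp
  -- norms
  have hKφnorm : ‖suzukiK φ‖ = ‖E‖ := by
    rw [norm_suzukiK, hφ_def, norm_suzukiJ, hR_def]
    exact Lp.norm_compMeasurePreserving _ _
  -- the estimate
  set c : ℂ := conj (lagariasTheta z) with hc
  have hdecomp : inner ℂ E ψ = inner ℂ (E - c • suzukiK φ) ψ := by
    rw [inner_sub_left, inner_smul_left, horth, mul_zero, sub_zero]
  have hnorm : ‖E - c • suzukiK φ‖ ^ 2 = ‖E‖ ^ 2 * (1 - ‖lagariasTheta z‖ ^ 2) := by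
    rw [@norm_sub_sq ℂ, inner_smul_right, hT, norm_smul, hKφnorm, hc, Complex.norm_conj, mul_pow]
    have : RCLike.re (conj (lagariasTheta z) * (lagariasTheta z * ((‖E‖ ^ 2 : ℝ) : ℂ))) =
        ‖lagariasTheta z‖ ^ 2 * ‖E‖ ^ 2 := by
      rw [← mul_assoc, mul_comm (conj _), Complex.mul_conj, Complex.normSq_eq_norm_sq]
      norm_cast
    rw [this]
    ring
  calc ‖upperHalfHat ψ z‖ ^ 2 = ‖inner ℂ (E - c • suzukiK φ) ψ‖ ^ 2 := by rw [hhat, hdecomp]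
    _ ≤ (‖E - c • suzukiK φ‖ * ‖ψ‖) ^ 2 :=
        pow_le_pow_left₀ (norm_nonneg _) (norm_inner_le_norm _ _) 2
    _ = ‖ψ‖ ^ 2 * (‖E‖ ^ 2 * (1 - ‖lagariasTheta z‖ ^ 2)) := by rw [mul_pow, hnorm]; ring
    _ = ‖ψ‖ ^ 2 * ((1 - ‖lagariasTheta z‖ ^ 2) / (2 * z.im)) := by rw [hEnorm]; ring

/-- **Conrey–Li's inequality (2.1) / de Branges' axiom for `Φ = E_ξψ̂` on the upper half-plane
(under RH)**: for `ψ ∈ V(0)` and `Im z > 0`, `|E(z)ψ̂(z)|² ≤ 2π‖ψ‖² · K(z,z)` with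
`K(z,z) = (|E(z)|² − |E(z̄)|²)/(4π Im z)` (`deBrangesKernelDiag`) and `2π‖ψ‖² = ‖𝖥ψ‖²_{L²} =
‖Eψ̂‖²_{𝓗(E)}`. RH-CONSEQUENCE. [cite: Suzuki2025WeilHilbertSpace, CJM §2.2 eq. (2.4)–(2.6) p. 4 and Lemma 5.1 p. 13] -/
theorem norm_sq_lagariasE_mul_upperHalfHat_le (hRH : RiemannHypothesis)
    {ψ : Lp ℂ 2 (volume : Measure ℝ)} (hψ : ψ ∈ suzukiV 0) {z : ℂ} (hz : 0 < z.im) :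
    ‖lagariasE z * upperHalfHat ψ z‖ ^ 2 ≤
      2 * π * ‖ψ‖ ^ 2 * deBrangesKernelDiag lagariasE z := by
  have h := norm_sq_upperHalfHat_le_of_mem_suzukiV hRH hψ hz
  have hE : lagariasE z ≠ 0 := lagariasE_ne_zero_of_im_pos hRH hz
  have hEpos : 0 < ‖lagariasE z‖ := norm_pos_iff.2 hE
  have hΘ : ‖lagariasTheta z‖ = ‖lagariasE (conj z)‖ / ‖lagariasE z‖ := by
    rw [lagariasTheta, norm_div, norm_sharp]
  rw [norm_mul, mul_pow, deBrangesKernelDiag]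
  calc ‖lagariasE z‖ ^ 2 * ‖upperHalfHat ψ z‖ ^ 2
      ≤ ‖lagariasE z‖ ^ 2 * (‖ψ‖ ^ 2 * ((1 - ‖lagariasTheta z‖ ^ 2) / (2 * z.im))) :=
        mul_le_mul_of_nonneg_left h (sq_nonneg _)
    _ = 2 * π * ‖ψ‖ ^ 2 * ((‖lagariasE z‖ ^ 2 - ‖lagariasE (conj z)‖ ^ 2) / (4 * π * z.im)) := by
        rw [hΘ, div_pow]
        field_simp
        ring

end SuzukiKernelBound

end Literature.NumberTheory.LFunctions
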